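import Literature.MathematicalPhysics.QuantumFieldTheory.Balaban1983to89.Beta.WindowIdentification
import Literature.MathematicalPhysics.QuantumFieldTheory.Balaban1983to89.Beta.StepDriftWitness

/-!
# `BalabanUV.Beta.D1BFx.ContactCount` — road «BF-x» for binder row D1, leaf A6: CONTACT / TADPOLE TERMS ARE `O(1)` — (i) tadpole
# `Tr[A∘W₂]` and bubble `Tr[(A∘V)(A∘W)]` are bounded by the SUP of the propagator entries times the vertices' own unit-scale localisation
# constants (NO decay of the propagator used ⇒ uniform in the block size whenever the entry bound is); (ii) a kernel on `ℤ⁴` supported in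
# the sup-ball of radius `ρ` with coefficients `≤ B` has `|FULLSUM_w w_μw_ν·K(w)| ≤ (2ρ+1)⁴·ρ²·B`; (iii) kernels agreeing outside that ball
# have full sums differing by `≤ (2ρ+1)⁴·sup_ball|K₁ − K₂|`; (iv) convex base-point averages preserve every such bound

HONEST FRAMING (cell contract, verbatim): «discharging `BetaPertH` makes Bałaban's UV stability UNCONDITIONAL — a real
constructive-QFT result; it is NOT the continuum limit and NOT the Clay problem.»  HONEST DEPENDENCY (verbatim): «continuum YM
on T⁴ ⇐ BetaPertH ∧ nine spine estimates (0/9 proved); BetaPertH ⇐ (D1) ∧ (D4) ∧ CAP+tail; G-an2-4 gates asym, D1 and NE2/3/4.»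
This module is [folklore] bookkeeping on `ℤ^D` composed BY NAME from the tree (`ExpKernelCalculus.comp/tr/tadpole/bubble/hessKer`,
`BiLoc`, `VertexFamily(₂)`, `Zl`, `summable_exp_shift'`, `tsum_exp_shift'`; `StepDriftWitness.tadpole_zero`; `WindowIdentification.psum/fullSum/fullSum_of_support/
fullSum_add/tendsto_psum_of_support`; `TransferUV.card_annulus_zero`; `BubbleTransfer.abs_moment_le`).  It cites nothing, mints
no `Prop`, defines nothing, and asserts NOTHING about Bałaban's operators: the propagator `A`, the vertices `V, W`, the kernels
`K` are arbitrary.  It discharges nothing of the wall; NOT summit progress; NOT continuum, NOT Clay.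

WHY (skeleton `HOME/beta/skeletons/D1-b2b-balaban-beta-d1-p2.md` v1.4, node A, leaf A6 «CONTACT / TADPOLE TERMS (J4 and coincident
supports): finitely supported in `w` (`‖w‖∞ ≤ 2`) with n-uniformly bounded coefficients ⇒ `O(1)`»; claim table
`HOME/b2b-balaban-beta-d1-p2/LEAVES-BFx.md` row A6).  In the road's frame the fine one-loop kernel at blocking `n` is
`ExpKernelCalculus.hessKer A V W μ ν z = ½·tadpole A (W μ 0 ν z) − ½·bubble A (V μ 0) (V ν z)` (typer spec T7, `N := 1`: vertices
indexed by FINE bonds) with `A = Ga n a` the background-Feynman gluon propagator (T1) and `V, W` the first/second-order stencils of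
LOCAL operators (T4/T5).  Two facts make the contact terms harmless, and both are proved here ABSTRACTLY:
* the second-order vertex of a local operator couples only nearby bonds, so `z ↦ tadpole A (W μ 0 ν z)` is FINITELY SUPPORTED
  (`‖z‖∞ ≤ ρ`, `ρ = 2` for the Wilson action) — and a finitely supported kernel has `fullSum = ` a finite sum
  (`WindowIdentification.fullSum_of_support`), here weighted: `≤ (2ρ+1)⁴·ρ²·B` (§2);
* its COEFFICIENTS are uniform in `n` because a tadpole (and a bubble at a fixed offset) only sees the propagator through the
  SUP of its entries: `|tadpole A W₂| ≤ |F|²·C₀·Cw·Zl(δ)²`, `|bubble A V W| ≤ |F|⁴·C₀²·Cv·Cw·Zl(δ)⁴` when `|A x y a b| ≤ C₀` and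
  the vertices are bi-localised at the UNIT scale with their own `(Cv, Cw, δ)` (§1) — whereas the generic
  `ExpKernelCalculus.abs_tadpole_le/abs_bubble_le` use the DECAY of `A`, whose rate for `Ga n a` is `δ/n` and whose lattice constants
  `Zl(δ/n) ∼ n⁴` are useless here.  For road BF-x the entry bound `C₀` is leaf L1's window row (`|GfE − gFree| ≤ D₀/n²`, `gFree`
  bounded) — a HYPOTHESIS on a real parameter below, not a statement about Bałaban's propagator.
The «coincident supports» half of A6 (the finitely many small offsets where leaf A1's off-contact closed form `stK` does not apply)
is §3: replacing a kernel on the ball `‖w‖∞ ≤ ρ` by anything bounded changes `fullSum` by at most `(2ρ+1)⁴·(ρ²·)B` and keeps the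
partial sums convergent — the exact interface the assembler A7 needs (`fullSum K = fullSum K′ + finite`, `K′ :=` the closed form
continued into the ball).  §4: the base-point average `Σ_b wt b · X b` with convex weights (the `hwt0/hwt1` binders of
`D1BFx.RoadEnd.d1Drift_of_strongRoad`) preserves each bound.  §5: the torus-frame contact table of
`BubbleTable.contact_stencil` (`Σ_s g(α s − β s)·trace(m s)`) is bounded by `B_g·Σ_s |trace(m s)|` — stated over arbitrary
functions, so that frame is served too.

CONTENT (all [folklore]; `|F|` = `Fintype.card F`): §1 `abs_comp_le_of_entryBound`, `abs_comp_le_of_rightLoc`, `abs_tr_le_of_rightLoc`,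
**`abs_tadpole_le_of_entryBound`**, **`abs_bubble_le_of_entryBound`**, **`abs_hessKer_le_of_entryBound`** (every single offset of the one-loop
kernel is `O(1)` in the entry bound; `StepDriftWitness.tadpole_zero` reused); §2 `card_ball_le`, `abs_weight_le_of_mem_ball`, `abs_psum_weighted_le`,
**`abs_fullSum_weighted_le_of_support`**; §3 `fullSum_sub_fullSum_of_eqOn_far`, **`abs_fullSum_sub_fullSum_le_of_eqOn_far`** (+ weighted);
§4 `abs_sum_mul_le_of_convex`; §5 `abs_contactTable_le`; §6 **`abs_fullSum_tadpole_le`** — the A6 shape assembled for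
the tadpole half of `hessKer` on `ℤ⁴`: `≤ (2ρ+1)⁴·ρ²·(½·|F|²·C₀·Cw·Zl(δ)²)`, free of everything but `(ρ, |F|, C₀, Cw, δ)`.
-/

noncomputable section
open Finset Filter Topology
open Literature.Probability.LatticeModels (annulus)
open Literature.MathematicalPhysics.QuantumFieldTheory.Balaban1983to89
open Literature.MathematicalPhysics.QuantumFieldTheory.Balaban1983to89.Beta
open Literature.MathematicalPhysics.QuantumFieldTheory.Balaban1983to89.B12Sec2to5 (l1 l1_nonneg)
open ExpKernelCalculus (Site MKer comp tr bubble tadpole hessKer BiLoc VertexFamily VertexFamily₂ Zl Zl_nonneg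
  summable_exp_shift' tsum_exp_shift')
open DyadicShell (Pt toReal supNorm mem_annulus_iff)
open WindowIdentification (psum fullSum fullSum_of_support tendsto_psum_of_support fullSum_add fullSum_eq_of_tendsto
  tendsto_fullSum psum_eq_of_support)
open TransferUV (card_annulus_zero)
open BubbleTransfer (abs_moment_le)

namespace Summit.QuantumFields.BalabanUV.Beta.D1BFx.ContactCount

/-! ## §1 Tadpole and bubble under an ENTRY bound on the propagator (no decay used) -/

section EntryBound

variable {D : ℕ} {F : Type*} [Fintype F]

/-- [folklore] Termwise: an entry-bounded `A` (`|A x y a b| ≤ C₀`) against a kernel `W` bi-localised at `(p, q)`: the summand of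
`comp A W x z a b` at the middle site `y` is `≤ |F|·C₀·Cw·e^{−δ|z−q|₁}·e^{−δ|y−p|₁}`. -/
theorem abs_compTerm_le_of_entryBound {A W : MKer D F} {C₀ Cw δ : ℝ} (hC₀ : 0 ≤ C₀) (hA : ∀ x y a b, |A x y a b| ≤ C₀)
    {p q : Site D} (hW : BiLoc W p q Cw δ) (x z : Site D) (a b : F) (y : Site D) :
    |∑ f, A x y a f * W y z f b| ≤
      (Fintype.card F : ℝ) * (C₀ * Cw) * Real.exp (-δ * l1 (z - q)) * Real.exp (-δ * l1 (y - p)) := by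
  classical
  have hC : ∀ f, |A x y a f * W y z f b| ≤ (C₀ * Cw) * Real.exp (-δ * l1 (z - q)) * Real.exp (-δ * l1 (y - p)) := by
    intro f
    rw [abs_mul]
    have h2 := hA x y a f
    have h3 := hW y z f b
    calc |A x y a f| * |W y z f b| ≤ C₀ * (Cw * Real.exp (-δ * (l1 (y - p) + l1 (z - q)))) :=
          mul_le_mul h2 h3 (abs_nonneg _) hC₀
      _ = (C₀ * Cw) * Real.exp (-δ * l1 (z - q)) * Real.exp (-δ * l1 (y - p)) := by
          rw [show -δ * (l1 (y - p) + l1 (z - q)) = -δ * l1 (z - q) + -δ * l1 (y - p) by ring, Real.exp_add]; ring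
  calc |∑ f, A x y a f * W y z f b| ≤ ∑ f, |A x y a f * W y z f b| := Finset.abs_sum_le_sum_abs _ _
    _ ≤ ∑ _f : F, (C₀ * Cw) * Real.exp (-δ * l1 (z - q)) * Real.exp (-δ * l1 (y - p)) :=
        Finset.sum_le_sum fun f _ => hC f
    _ = _ := by rw [Finset.sum_const, Finset.card_univ, nsmul_eq_mul]; ring

/-- [folklore] **ENTRY-BOUNDED ∘ BI-LOCALISED IS LOCALISED IN THE SECOND VARIABLE**: `|A x y a b| ≤ C₀` and `W` bi-localised at
`(p, q)` with `(Cw, δ)`, `δ > 0` ⟹ `|(A∘W) x z a b| ≤ |F|·C₀·Cw·Zl(δ)·e^{−δ|z−q|₁}` for ALL `x` — the propagator enters only through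
`C₀`. -/
theorem abs_comp_le_of_entryBound {A W : MKer D F} {C₀ Cw δ : ℝ} (hC₀ : 0 ≤ C₀) (hA : ∀ x y a b, |A x y a b| ≤ C₀)
    {p q : Site D} (hW : BiLoc W p q Cw δ) (hδ : 0 < δ) (x z : Site D) (a b : F) :
    |comp A W x z a b| ≤ (Fintype.card F : ℝ) * (C₀ * Cw) * Zl D δ * Real.exp (-δ * l1 (z - q)) := by
  unfold ExpKernelCalculus.comp
  have hs := summable_exp_shift' hδ p
  have hmaj := hs.mul_left ((Fintype.card F : ℝ) * (C₀ * Cw) * Real.exp (-δ * l1 (z - q)))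
  have hb := tsum_of_norm_bounded hmaj.hasSum
    (fun y => by rw [Real.norm_eq_abs]; exact abs_compTerm_le_of_entryBound hC₀ hA hW x z a b y)
  rw [Real.norm_eq_abs] at hb
  refine hb.trans (le_of_eq ?_)
  rw [tsum_mul_left, tsum_exp_shift']
  ring

/-- [folklore] Termwise bound for the composition of two kernels each localised in its SECOND variable (`P` at `p` with constant `K₁`,
`Q` at `q` with `K₂`, common rate `δ`): the summand at `y` is `≤ |F|·K₁·K₂·e^{−δ|z−q|₁}·e^{−δ|y−p|₁}`. -/
theorem abs_compTerm_le_of_rightLoc {P Q : MKer D F} {K₁ K₂ δ : ℝ} {p q : Site D}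
    (hP : ∀ x y a b, |P x y a b| ≤ K₁ * Real.exp (-δ * l1 (y - p)))
    (hQ : ∀ y z a b, |Q y z a b| ≤ K₂ * Real.exp (-δ * l1 (z - q))) (x z : Site D) (a b : F) (y : Site D) :
    |∑ f, P x y a f * Q y z f b| ≤ (Fintype.card F : ℝ) * (K₁ * K₂) * Real.exp (-δ * l1 (z - q)) * Real.exp (-δ * l1 (y - p)) := by
  classical
  have hC : ∀ f, |P x y a f * Q y z f b| ≤ (K₁ * K₂) * Real.exp (-δ * l1 (z - q)) * Real.exp (-δ * l1 (y - p)) := by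
    intro f
    rw [abs_mul]
    have h2 := hP x y a f
    have h3 := hQ y z f b
    calc |P x y a f| * |Q y z f b| ≤ (K₁ * Real.exp (-δ * l1 (y - p))) * (K₂ * Real.exp (-δ * l1 (z - q))) :=
          mul_le_mul h2 h3 (abs_nonneg _) ((abs_nonneg _).trans h2)
      _ = (K₁ * K₂) * Real.exp (-δ * l1 (z - q)) * Real.exp (-δ * l1 (y - p)) := by ring
  calc |∑ f, P x y a f * Q y z f b| ≤ ∑ f, |P x y a f * Q y z f b| := Finset.abs_sum_le_sum_abs _ _
    _ ≤ ∑ _f : F, (K₁ * K₂) * Real.exp (-δ * l1 (z - q)) * Real.exp (-δ * l1 (y - p)) :=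
        Finset.sum_le_sum fun f _ => hC f
    _ = _ := by rw [Finset.sum_const, Finset.card_univ, nsmul_eq_mul]; ring

/-- [folklore] **SECOND-VARIABLE LOCALISATION COMPOSES**: `P` localised at `p` (constant `K₁`), `Q` at `q` (constant `K₂`), rate `δ > 0`
⟹ `P∘Q` localised at `q` with constant `|F|·K₁·K₂·Zl(δ)`. -/
theorem abs_comp_le_of_rightLoc {P Q : MKer D F} {K₁ K₂ δ : ℝ} {p q : Site D}
    (hP : ∀ x y a b, |P x y a b| ≤ K₁ * Real.exp (-δ * l1 (y - p)))
    (hQ : ∀ y z a b, |Q y z a b| ≤ K₂ * Real.exp (-δ * l1 (z - q))) (hδ : 0 < δ) (x z : Site D) (a b : F) :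
    |comp P Q x z a b| ≤ (Fintype.card F : ℝ) * (K₁ * K₂) * Zl D δ * Real.exp (-δ * l1 (z - q)) := by
  unfold ExpKernelCalculus.comp
  have hs := summable_exp_shift' hδ p
  have hmaj := hs.mul_left ((Fintype.card F : ℝ) * (K₁ * K₂) * Real.exp (-δ * l1 (z - q)))
  have hb := tsum_of_norm_bounded hmaj.hasSum
    (fun y => by rw [Real.norm_eq_abs]; exact abs_compTerm_le_of_rightLoc hP hQ x z a b y)
  rw [Real.norm_eq_abs] at hb
  refine hb.trans (le_of_eq ?_)
  rw [tsum_mul_left, tsum_exp_shift']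
  ring

/-- [folklore] Termwise trace bound for a kernel localised in its second variable at `q`: `|Σ_a P x x a a| ≤ |F|·K·e^{−δ|x−q|₁}`. -/
theorem abs_trTerm_le_of_rightLoc {P : MKer D F} {K δ : ℝ} {q : Site D}
    (hP : ∀ x y a b, |P x y a b| ≤ K * Real.exp (-δ * l1 (y - q))) (x : Site D) :
    |∑ a, P x x a a| ≤ (Fintype.card F : ℝ) * K * Real.exp (-δ * l1 (x - q)) := by
  classical
  calc |∑ a, P x x a a| ≤ ∑ a, |P x x a a| := Finset.abs_sum_le_sum_abs _ _
    _ ≤ ∑ _a : F, K * Real.exp (-δ * l1 (x - q)) := Finset.sum_le_sum fun a _ => hP x x a a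
    _ = _ := by rw [Finset.sum_const, Finset.card_univ, nsmul_eq_mul]; ring

/-- [folklore] **TRACE OF A SECOND-VARIABLE-LOCALISED KERNEL**: `|tr P| ≤ |F|·K·Zl(δ)`. -/
theorem abs_tr_le_of_rightLoc {P : MKer D F} {K δ : ℝ} {q : Site D}
    (hP : ∀ x y a b, |P x y a b| ≤ K * Real.exp (-δ * l1 (y - q))) (hδ : 0 < δ) :
    |tr P| ≤ (Fintype.card F : ℝ) * K * Zl D δ := by
  unfold ExpKernelCalculus.tr
  have hs := summable_exp_shift' hδ q
  have hmaj := hs.mul_left ((Fintype.card F : ℝ) * K)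
  have hb := tsum_of_norm_bounded hmaj.hasSum
    (fun x => by rw [Real.norm_eq_abs]; exact abs_trTerm_le_of_rightLoc hP x)
  rw [Real.norm_eq_abs] at hb
  refine hb.trans (le_of_eq ?_)
  rw [tsum_mul_left, tsum_exp_shift']

/-- [folklore] **TADPOLE UNDER AN ENTRY BOUND.**  `|A x y a b| ≤ C₀`, `W₂` bi-localised at `(p, q)` with `(Cw, δ)`, `δ > 0` ⟹
`|tadpole A W₂| ≤ |F|·(|F|·C₀·Cw·Zl δ)·Zl δ` — independent of `(p, q)` and of any decay of `A`.  (For road BF-x: `A = Ga n a` with the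
`n`-uniform entry bound of leaf L1, `W₂` a second-order stencil of a local operator, localised at the unit scale — so the contact
coefficient is `O(1)` uniformly in the block size.) -/
theorem abs_tadpole_le_of_entryBound {A W₂ : MKer D F} {C₀ Cw δ : ℝ} (hC₀ : 0 ≤ C₀) (hA : ∀ x y a b, |A x y a b| ≤ C₀)
    {p q : Site D} (hW : BiLoc W₂ p q Cw δ) (hδ : 0 < δ) :
    |tadpole A W₂| ≤ (Fintype.card F : ℝ) * ((Fintype.card F : ℝ) * (C₀ * Cw) * Zl D δ) * Zl D δ := by
  unfold ExpKernelCalculus.tadpole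
  exact abs_tr_le_of_rightLoc (q := q) (fun x y a b => abs_comp_le_of_entryBound hC₀ hA hW hδ x y a b) hδ

/-- [folklore] **BUBBLE UNDER AN ENTRY BOUND.**  `|A x y a b| ≤ C₀`, `V` bi-localised at `(p, p)` with `(Cv, δ)`, `W` at `(q, q)` with
`(Cw, δ)`, `δ > 0` ⟹ `|bubble A V W| ≤ |F|·(|F|·(|F|·C₀·Cv·Zl δ)·(|F|·C₀·Cw·Zl δ)·Zl δ)·Zl δ` — independent of `p, q` and of any decay of
`A` (no smallness in `|p − q|₁` is claimed: this is the bound for the finitely many NEAR-CONTACT offsets; far offsets are leaf A1's). -/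
theorem abs_bubble_le_of_entryBound {A V W : MKer D F} {C₀ Cv Cw δ : ℝ} (hC₀ : 0 ≤ C₀) (hA : ∀ x y a b, |A x y a b| ≤ C₀)
    {p q : Site D} (hV : BiLoc V p p Cv δ) (hW : BiLoc W q q Cw δ) (hδ : 0 < δ) :
    |bubble A V W| ≤
      (Fintype.card F : ℝ) *
          ((Fintype.card F : ℝ) * (((Fintype.card F : ℝ) * (C₀ * Cv) * Zl D δ) * ((Fintype.card F : ℝ) * (C₀ * Cw) * Zl D δ)) *
            Zl D δ) * Zl D δ := by
  unfold ExpKernelCalculus.bubble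
  have hP : ∀ x y a b, |comp A V x y a b| ≤ ((Fintype.card F : ℝ) * (C₀ * Cv) * Zl D δ) * Real.exp (-δ * l1 (y - p)) :=
    fun x y a b => abs_comp_le_of_entryBound hC₀ hA hV hδ x y a b
  have hQ : ∀ y z a b, |comp A W y z a b| ≤ ((Fintype.card F : ℝ) * (C₀ * Cw) * Zl D δ) * Real.exp (-δ * l1 (z - q)) :=
    fun y z a b => abs_comp_le_of_entryBound hC₀ hA hW hδ y z a b
  exact abs_tr_le_of_rightLoc (q := q) (fun x z a b => abs_comp_le_of_rightLoc hP hQ hδ x z a b) hδ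

/-- [folklore] **EVERY SINGLE OFFSET OF THE ONE-LOOP KERNEL IS `O(1)` IN THE ENTRY BOUND.**  For an entry-bounded `A` and vertex families
`V` (first order, constant `Cv`) and `W` (second order, constant `Cw`) bi-localised at the blocked bond positions with rate `δ > 0` (ANY
blocking `N`), `|hessKer A V W μ ν z| ≤ ½·T + ½·B` with the tadpole/bubble constants of `abs_tadpole_le_of_entryBound` /
`abs_bubble_le_of_entryBound` — uniformly in `μ, ν, z, N`. -/
theorem abs_hessKer_le_of_entryBound {A : MKer D F} {V : Fin D → Site D → MKer D F} {W : Fin D → Site D → Fin D → Site D → MKer D F}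
    {C₀ Cv Cw δ : ℝ} {N : ℕ} (hC₀ : 0 ≤ C₀) (hA : ∀ x y a b, |A x y a b| ≤ C₀) (hV : VertexFamily V N Cv δ)
    (hW : VertexFamily₂ W N Cw δ) (hδ : 0 < δ) (μ ν : Fin D) (z : Site D) :
    |hessKer A V W μ ν z| ≤
      (1 / 2) * ((Fintype.card F : ℝ) * ((Fintype.card F : ℝ) * (C₀ * Cw) * Zl D δ) * Zl D δ) +
        (1 / 2) * ((Fintype.card F : ℝ) *
          ((Fintype.card F : ℝ) * (((Fintype.card F : ℝ) * (C₀ * Cv) * Zl D δ) * ((Fintype.card F : ℝ) * (C₀ * Cv) * Zl D δ)) *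
            Zl D δ) * Zl D δ) := by
  unfold ExpKernelCalculus.hessKer
  have ht := abs_tadpole_le_of_entryBound hC₀ hA (hW μ 0 ν z) hδ
  have hb := abs_bubble_le_of_entryBound hC₀ hA (hV μ 0) (hV ν z) hδ
  calc |(1 / 2 : ℝ) * tadpole A (W μ 0 ν z) - 1 / 2 * bubble A (V μ 0) (V ν z)|
      ≤ |(1 / 2 : ℝ) * tadpole A (W μ 0 ν z)| + |1 / 2 * bubble A (V μ 0) (V ν z)| := abs_sub _ _
    _ = (1 / 2) * |tadpole A (W μ 0 ν z)| + (1 / 2) * |bubble A (V μ 0) (V ν z)| := by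
        rw [abs_mul, abs_mul, abs_of_pos (by norm_num : (0 : ℝ) < 1 / 2)]
    _ ≤ _ := add_le_add (mul_le_mul_of_nonneg_left ht (by norm_num)) (mul_le_mul_of_nonneg_left hb (by norm_num))

end EntryBound

/-! ## §2 Finitely supported kernels on `ℤ⁴`: the weighted full sum is a finite sum, bounded by `(2ρ+1)⁴·ρ²·B` -/

section Support

/-- [folklore] The punctured sup-ball of radius `ρ` in `ℤ⁴` has at most `(2ρ+1)⁴` points (`TransferUV.card_annulus_zero`:
exactly `(2ρ+1)⁴ − 1`). -/
theorem card_ball_le (ρ : ℕ) : ((annulus 4 0 ρ).card : ℝ) ≤ (2 * (ρ : ℝ) + 1) ^ 4 := by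
  rw [card_annulus_zero]
  have h : ((2 * ρ + 1) ^ 4 - 1 : ℕ) ≤ (2 * ρ + 1) ^ 4 := Nat.sub_le _ _
  calc (((2 * ρ + 1) ^ 4 - 1 : ℕ) : ℝ) ≤ (((2 * ρ + 1) ^ 4 : ℕ) : ℝ) := by exact_mod_cast h
    _ = (2 * (ρ : ℝ) + 1) ^ 4 := by push_cast; ring

/-- [folklore] On the punctured ball of sup-radius `ρ` the (1.22)-weight costs at most `ρ²`: `|w_μ w_ν| ≤ ρ²`. -/
theorem abs_weight_le_of_mem_ball {ρ : ℕ} {w : Pt} (hw : w ∈ annulus 4 0 ρ) (μ ν : Fin 4) :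
    |toReal w μ * toReal w ν| ≤ (ρ : ℝ) ^ 2 := by
  have h := (mem_annulus_iff.mp hw).2
  calc |toReal w μ * toReal w ν| ≤ (supNorm w : ℝ) ^ 2 := abs_moment_le μ ν w
    _ ≤ (ρ : ℝ) ^ 2 := by gcongr

/-- [folklore] **THE WEIGHTED FINITE SUM OVER THE BALL**: `|f w| ≤ B` (`B ≥ 0`) on `0 < ‖w‖∞ ≤ ρ` ⟹
`|psum (w ↦ w_μw_ν·f w) ρ| ≤ (2ρ+1)⁴·ρ²·B`. -/
theorem abs_psum_weighted_le {f : Pt → ℝ} {ρ : ℕ} {B : ℝ} (hB0 : 0 ≤ B) (hB : ∀ w ∈ annulus 4 0 ρ, |f w| ≤ B) (μ ν : Fin 4) :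
    |psum (fun w => toReal w μ * toReal w ν * f w) ρ| ≤ (2 * (ρ : ℝ) + 1) ^ 4 * ((ρ : ℝ) ^ 2 * B) := by
  rw [psum]
  calc |∑ w ∈ annulus 4 0 ρ, toReal w μ * toReal w ν * f w| ≤ ∑ w ∈ annulus 4 0 ρ, |toReal w μ * toReal w ν * f w| :=
        Finset.abs_sum_le_sum_abs _ _
    _ ≤ ∑ _w ∈ annulus 4 0 ρ, (ρ : ℝ) ^ 2 * B := by
        refine Finset.sum_le_sum fun w hw => ?_
        rw [abs_mul]
        exact mul_le_mul (abs_weight_le_of_mem_ball hw μ ν) (hB w hw) (abs_nonneg _) (by positivity)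
    _ = ((annulus 4 0 ρ).card : ℝ) * ((ρ : ℝ) ^ 2 * B) := by rw [Finset.sum_const, nsmul_eq_mul]
    _ ≤ (2 * (ρ : ℝ) + 1) ^ 4 * ((ρ : ℝ) ^ 2 * B) :=
        mul_le_mul_of_nonneg_right (card_ball_le ρ) (by positivity)

/-- [folklore] **A FINITELY SUPPORTED CONTACT KERNEL HAS A BLOCK-SIZE-FREE WEIGHTED FULL SUM**: if `f` vanishes beyond sup-radius `ρ`
and `|f w| ≤ B` on the punctured ball, then `|fullSum (w ↦ w_μw_ν·f w)| ≤ (2ρ+1)⁴·ρ²·B` — the full lattice sum IS the finite sum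
over the ball (`WindowIdentification.fullSum_of_support`).  In road BF-x: `ρ = 2`, `B` = the `n`-uniform coefficient bound of §1. -/
theorem abs_fullSum_weighted_le_of_support {f : Pt → ℝ} {ρ : ℕ} {B : ℝ} (hB0 : 0 ≤ B)
    (hf : ∀ w : Pt, ρ < supNorm w → f w = 0) (hB : ∀ w ∈ annulus 4 0 ρ, |f w| ≤ B) (μ ν : Fin 4) :
    |fullSum (fun w => toReal w μ * toReal w ν * f w)| ≤ (2 * (ρ : ℝ) + 1) ^ 4 * ((ρ : ℝ) ^ 2 * B) := by
  have hK : ∀ w : Pt, ρ < supNorm w → toReal w μ * toReal w ν * f w = 0 := fun w hw => by rw [hf w hw, mul_zero]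
  have h := abs_psum_weighted_le hB0 hB μ ν
  rw [WindowIdentification.psum_def] at h
  rwa [fullSum_of_support hK]

/-- [folklore] … and its weighted partial sums converge (the `∃ B, Tendsto (psum ·) atTop (𝓝 B)` slot of
`WindowIdentification.fullSum_add`, for the assembler). -/
theorem exists_tendsto_psum_weighted_of_support {f : Pt → ℝ} {ρ : ℕ} (hf : ∀ w : Pt, ρ < supNorm w → f w = 0) (μ ν : Fin 4) :
    ∃ L : ℝ, Tendsto (psum (fun w => toReal w μ * toReal w ν * f w)) atTop (𝓝 L) :=
  ⟨_, tendsto_psum_of_support (R₁ := ρ) (fun w hw => by rw [hf w hw, mul_zero])⟩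

end Support

/-! ## §3 «Coincident supports»: kernels agreeing outside the ball differ by a finite sum -/

section EqOnFar

/-- [folklore] If `K₁ = K₂` beyond sup-radius `ρ` and `K₂` has convergent punctured partial sums, so does `K₁`. -/
theorem exists_tendsto_psum_of_eqOn_far {K₁ K₂ : Pt → ℝ} {ρ : ℕ} (hfar : ∀ w : Pt, ρ < supNorm w → K₁ w = K₂ w)
    (h₂ : ∃ L : ℝ, Tendsto (psum K₂) atTop (𝓝 L)) : ∃ L : ℝ, Tendsto (psum K₁) atTop (𝓝 L) := by
  have hd : ∀ w : Pt, ρ < supNorm w → K₁ w - K₂ w = 0 := fun w hw => by rw [hfar w hw, sub_self]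
  have e : (fun w => K₂ w + (K₁ w - K₂ w)) = K₁ := funext fun w => by ring
  have h := WindowIdentification.exists_tendsto_psum_add h₂ ⟨_, tendsto_psum_of_support hd⟩
  rwa [e] at h

/-- [folklore] **TWO KERNELS THAT AGREE OFF THE BALL DIFFER BY THE FINITE SUM OF THEIR DIFFERENCE OVER THE BALL**:
`fullSum K₁ − fullSum K₂ = Σ_{0<‖w‖∞≤ρ} (K₁ w − K₂ w)`. -/
theorem fullSum_sub_fullSum_of_eqOn_far {K₁ K₂ : Pt → ℝ} {ρ : ℕ} (hfar : ∀ w : Pt, ρ < supNorm w → K₁ w = K₂ w)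
    (h₂ : ∃ L : ℝ, Tendsto (psum K₂) atTop (𝓝 L)) :
    fullSum K₁ - fullSum K₂ = ∑ w ∈ annulus 4 0 ρ, (K₁ w - K₂ w) := by
  have hd : ∀ w : Pt, ρ < supNorm w → K₁ w - K₂ w = 0 := fun w hw => by rw [hfar w hw, sub_self]
  have e : (fun w => K₂ w + (K₁ w - K₂ w)) = K₁ := funext fun w => by ring
  have h := fullSum_add h₂ ⟨_, tendsto_psum_of_support hd⟩
  rw [e] at h
  rw [h, fullSum_of_support hd]
  ring

/-- [folklore] **THE NEAR-CONTACT CORRECTION IS `O(1)`**: `K₁ = K₂` off the ball of sup-radius `ρ`, `|K₁ − K₂| ≤ B` (`B ≥ 0`) on it,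
`K₂` with convergent partial sums ⟹ `|fullSum K₁ − fullSum K₂| ≤ (2ρ+1)⁴·B`.  (A7: `K₁` = the actual weighted fine kernel at base point
`b`, `K₂` = leaf A1's closed form continued into the ball; `B` free of the block size by §1.) -/
theorem abs_fullSum_sub_fullSum_le_of_eqOn_far {K₁ K₂ : Pt → ℝ} {ρ : ℕ} {B : ℝ} (hB0 : 0 ≤ B)
    (hfar : ∀ w : Pt, ρ < supNorm w → K₁ w = K₂ w) (h₂ : ∃ L : ℝ, Tendsto (psum K₂) atTop (𝓝 L))
    (hB : ∀ w ∈ annulus 4 0 ρ, |K₁ w - K₂ w| ≤ B) : |fullSum K₁ - fullSum K₂| ≤ (2 * (ρ : ℝ) + 1) ^ 4 * B := by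
  rw [fullSum_sub_fullSum_of_eqOn_far hfar h₂]
  calc |∑ w ∈ annulus 4 0 ρ, (K₁ w - K₂ w)| ≤ ∑ w ∈ annulus 4 0 ρ, |K₁ w - K₂ w| := Finset.abs_sum_le_sum_abs _ _
    _ ≤ ∑ _w ∈ annulus 4 0 ρ, B := Finset.sum_le_sum hB
    _ = ((annulus 4 0 ρ).card : ℝ) * B := by rw [Finset.sum_const, nsmul_eq_mul]
    _ ≤ (2 * (ρ : ℝ) + 1) ^ 4 * B := mul_le_mul_of_nonneg_right (card_ball_le ρ) hB0

/-- [folklore] The same with the (1.22)-weight made explicit: unweighted kernels `f₁ = f₂` off the ball, `|f₁ − f₂| ≤ B` on it ⟹ the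
weighted full sums differ by at most `(2ρ+1)⁴·ρ²·B`. -/
theorem abs_fullSum_sub_fullSum_weighted_le_of_eqOn_far {f₁ f₂ : Pt → ℝ} {ρ : ℕ} {B : ℝ} (hB0 : 0 ≤ B)
    (hfar : ∀ w : Pt, ρ < supNorm w → f₁ w = f₂ w)
    (h₂ : ∀ μ ν : Fin 4, ∃ L : ℝ, Tendsto (psum (fun w => toReal w μ * toReal w ν * f₂ w)) atTop (𝓝 L))
    (hB : ∀ w ∈ annulus 4 0 ρ, |f₁ w - f₂ w| ≤ B) (μ ν : Fin 4) :
    |fullSum (fun w => toReal w μ * toReal w ν * f₁ w) - fullSum (fun w => toReal w μ * toReal w ν * f₂ w)| ≤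
      (2 * (ρ : ℝ) + 1) ^ 4 * ((ρ : ℝ) ^ 2 * B) := by
  refine abs_fullSum_sub_fullSum_le_of_eqOn_far (by positivity) (fun w hw => by rw [hfar w hw]) (h₂ μ ν) fun w hw => ?_
  rw [← mul_sub, abs_mul]
  exact mul_le_mul (abs_weight_le_of_mem_ball hw μ ν) (hB w hw) (abs_nonneg _) (by positivity)

end EqOnFar

/-! ## §4 Convex base-point averages preserve every bound -/

section Average

/-- [folklore] **BASE-POINT AVERAGE.**  Convex weights (`wt ≥ 0`, `Σ wt = 1` — the `hwt0/hwt1` binders of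
`D1BFx.RoadEnd.d1Drift_of_strongRoad`) and `|X b| ≤ B` for every base point ⟹ `|Σ_b wt b · X b| ≤ B`. -/
theorem abs_sum_mul_le_of_convex {κ : Type*} (s : Finset κ) {wt X : κ → ℝ} {B : ℝ} (h0 : ∀ b ∈ s, 0 ≤ wt b)
    (h1 : ∑ b ∈ s, wt b = 1) (hX : ∀ b ∈ s, |X b| ≤ B) : |∑ b ∈ s, wt b * X b| ≤ B := by
  calc |∑ b ∈ s, wt b * X b| ≤ ∑ b ∈ s, |wt b * X b| := Finset.abs_sum_le_sum_abs _ _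
    _ ≤ ∑ b ∈ s, wt b * B := Finset.sum_le_sum fun b hb => by
        rw [abs_mul, abs_of_nonneg (h0 b hb)]
        exact mul_le_mul_of_nonneg_left (hX b hb) (h0 b hb)
    _ = B := by rw [← Finset.sum_mul, h1, one_mul]

end Average

/-! ## §5 The torus-frame contact table (`BubbleTable.contact_stencil` shape) -/

section Table

/-- [folklore] **CONTACT TABLE BOUND** (the shape `Σ_{s∈S} g(α s − β s)·trace(m s)` of `BubbleTable.contact_stencil`, stated over
arbitrary functions: `o s` the contact offset of stencil point `s`, `t s` its coefficient): if `|g| ≤ Bg` at the finitely many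
contact offsets then `|Σ_s g(o s)·t s| ≤ Bg·Σ_s |t s|` — the coefficients `t` do not see the propagator, the propagator enters only
through its values at BOUNDED offsets. -/
theorem abs_contactTable_le {Λ σ : Type*} (S : Finset σ) (g : Λ → ℝ) (o : σ → Λ) (t : σ → ℝ) {Bg : ℝ}
    (hg : ∀ s ∈ S, |g (o s)| ≤ Bg) : |∑ s ∈ S, g (o s) * t s| ≤ Bg * ∑ s ∈ S, |t s| := by
  calc |∑ s ∈ S, g (o s) * t s| ≤ ∑ s ∈ S, |g (o s) * t s| := Finset.abs_sum_le_sum_abs _ _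
    _ ≤ ∑ s ∈ S, Bg * |t s| := Finset.sum_le_sum fun s hs => by
        rw [abs_mul]
        exact mul_le_mul_of_nonneg_right (hg s hs) (abs_nonneg _)
    _ = Bg * ∑ s ∈ S, |t s| := by rw [Finset.mul_sum]

end Table

/-! ## §6 The A6 shape assembled: the tadpole half of `hessKer` on `ℤ⁴` -/

section Assembled

variable {F : Type*} [Fintype F]

/-- [folklore] **LEAF A6, TADPOLE HALF, IN FINAL FORM.**  On `ℤ⁴`: an ENTRY-BOUNDED propagator `A` (`|A x y a b| ≤ C₀`), a second-order
vertex family `W` bi-localised at the blocked bond positions with `(Cw, δ)`, `δ > 0` (ANY blocking `N`), whose member `W μ 0 ν z` VANISHES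
for offsets beyond sup-radius `ρ` (locality of the second-order vertex) ⟹ the weighted full lattice sum of the tadpole half of the one-loop
kernel obeys `|fullSum (w ↦ w_μw_ν·½·tadpole A (W μ 0 ν w))| ≤ (2ρ+1)⁴·ρ²·½·|F|²·C₀·Cw·Zl(δ)²` — a bound free of everything except
`(ρ, |F|, C₀, Cw, δ)`; for road BF-x all five are free of the block size `n`, which is the `O(1)` of leaf A6 for the tadpole/contact terms.
Nothing about Bałaban's operators is asserted: `A`, `W` are arbitrary. -/
theorem abs_fullSum_tadpole_le {A : MKer 4 F} {W : Fin 4 → Site 4 → Fin 4 → Site 4 → MKer 4 F} {C₀ Cw δ : ℝ} {N ρ : ℕ}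
    (hC₀ : 0 ≤ C₀) (hA : ∀ x y a b, |A x y a b| ≤ C₀) (hW : VertexFamily₂ W N Cw δ) (hδ : 0 < δ) (μ ν : Fin 4)
    (hsupp : ∀ z : Pt, ρ < supNorm z → W μ 0 ν z = 0) :
    |fullSum (fun w => toReal w μ * toReal w ν * ((1 / 2) * tadpole A (W μ 0 ν w)))| ≤
      (2 * (ρ : ℝ) + 1) ^ 4 *
        ((ρ : ℝ) ^ 2 * ((1 / 2) * ((Fintype.card F : ℝ) * ((Fintype.card F : ℝ) * (C₀ * Cw) * Zl 4 δ) * Zl 4 δ))) := by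
  -- the coefficient bound is nonnegative (empty fibre: `|F| = 0`; otherwise `Cw ≥ 0` is read off the localisation bound)
  have hB0 : 0 ≤ (1 / 2) * ((Fintype.card F : ℝ) * ((Fintype.card F : ℝ) * (C₀ * Cw) * Zl 4 δ) * Zl 4 δ) := by
    rcases isEmpty_or_nonempty F with hF | ⟨⟨a⟩⟩
    · simp [Fintype.card_eq_zero]
    · have hCw : 0 ≤ Cw := (hW μ 0 ν 0).nonneg a
      have hZ : 0 ≤ Zl 4 δ := Zl_nonneg hδ
      positivity
  have hf : ∀ w : Pt, ρ < supNorm w → (1 / 2) * tadpole A (W μ 0 ν w) = 0 := fun w hw => by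
    rw [hsupp w hw, StepDriftWitness.tadpole_zero, mul_zero]
  refine abs_fullSum_weighted_le_of_support hB0 hf (fun w _ => ?_) μ ν
  rw [abs_mul, abs_of_pos (by norm_num : (0 : ℝ) < 1 / 2)]
  exact mul_le_mul_of_nonneg_left (abs_tadpole_le_of_entryBound hC₀ hA (hW μ 0 ν w) hδ) (by norm_num)

end Assembled

end Summit.QuantumFields.BalabanUV.Beta.D1BFx.ContactCount
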